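import Literature.NumberTheory.LFunctions.RudnickSarnakNExchange
import Literature.NumberTheory.LFunctions.RudnickSarnakNPrimeSums
import Mathlib.Data.Nat.Squarefree
import Mathlib.Analysis.SpecialFunctions.Pow.NNReal
import HarnessLib

/-!
# Rudnick–Sarnak `n`-level correlations for `ζ`, VIII: the diagonal configurations

Sibling file of `Literature/NumberTheory/LFunctions/RudnickSarnak.lean` (toward
`Literature.NumberTheory.LFunctions.rudnick_sarnak_unrestricted` at every level). The arithmetic
of the diagonal `M = N` of Rudnick–Sarnak 1996, Lemmas 3.7–3.10 (pp. 296–301): the configurations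
`(n_1, …, n_r; m_1, …, m_s)` of prime powers with `n_1 ⋯ n_r = m_1 ⋯ m_s` are split into

* **good** configurations: all entries prime, distinct on each side — these force `r = s` and
  `m = n ∘ σ` for a unique permutation `σ` (Lemma 3.10: "the main term will be contributed by the
  permutations of distinct prime factors"; `RudnickSarnakN.sum_good_eq_sum_perm`,
  `RudnickSarnakN.sum_good_eq_zero_of_ne`), and
* the rest (a proper prime power somewhere, or a repeated prime on one side), whose weight after
  the slice integration, `w(n; m) = Π Λ(n_i)/√n_i · Π Λ(m_j)/√m_j` subject to `Π n = Π m`, is one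
  logarithm smaller than the crude bound (Lemmas 3.8–3.9: "`O(log^{2r−2} x)` unless `r = s` and
  `a = b = 1`"; `RudnickSarnakN.sum_cfgWeight_bad_le` versus `RudnickSarnakN.sum_cfgWeight_le`).

All statements are over tuples `ν ∈ [1, N]^r`, `μ ∈ [1, N]^s` (`RudnickSarnakN.tuples`) and are
purely arithmetic; the inputs are `(Λ^{*s})(P) ≤ (log P)^s` (`RudnickSarnakN.vonMangoldt_pow_le`),
the tuple expansion (`ArithmeticFunction.prod_apply_eq_sum_finMulAntidiag`) and the elementary
prime sums of `RudnickSarnakNPrimeSums.lean`.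

## References

* Z. Rudnick, P. Sarnak, *Zeros of principal `L`-functions and random matrix theory*, Duke Math.
  J. 81 (1996), 269–322, Lemmas 3.7–3.10.
-/

noncomputable section

open Finset
open ArithmeticFunction (vonMangoldt_nonneg vonMangoldt_le_log)
open scoped Real ArithmeticFunction.vonMangoldt

namespace Literature.NumberTheory.LFunctions

namespace RudnickSarnakN

variable {r s : ℕ}

/-! ## Tuples, weights, good configurations -/

/-- The tuples `[1, N]^r`. [folklore] -/
def tuples (r N : ℕ) : Finset (Fin r → ℕ) :=
  Fintype.piFinset fun _ ↦ Finset.Icc 1 N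

/-- Membership in `tuples`. [folklore] -/
theorem mem_tuples {r N : ℕ} {ν : Fin r → ℕ} : ν ∈ tuples r N ↔ ∀ i, 1 ≤ ν i ∧ ν i ≤ N := by
  simp [tuples, Fintype.mem_piFinset]

/-- The weight of a configuration after the slice integration:
`w(ν; μ) = Π_i Λ(ν_i)/√ν_i · Π_j Λ(μ_j)/√μ_j`. (Rudnick–Sarnak 1996, (3.46): the factor
`(n_1 ⋯ n_{r+s})^{−1/2} Π c(n_i)`.) [cite: RudnickSarnak1996, (3.46)] -/
def cfgWeight (ν : Fin r → ℕ) (μ : Fin s → ℕ) : ℝ :=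
  (∏ i, (Λ (ν i) : ℝ) / Real.sqrt (ν i)) * ∏ j, (Λ (μ j) : ℝ) / Real.sqrt (μ j)

/-- `w ≥ 0`. [folklore] -/
theorem cfgWeight_nonneg (ν : Fin r → ℕ) (μ : Fin s → ℕ) : 0 ≤ cfgWeight ν μ :=
  mul_nonneg (Finset.prod_nonneg fun _ _ ↦ div_nonneg vonMangoldt_nonneg (Real.sqrt_nonneg _))
    (Finset.prod_nonneg fun _ _ ↦ div_nonneg vonMangoldt_nonneg (Real.sqrt_nonneg _))

/-- Good configurations: all entries prime and pairwise distinct on each side.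
(Rudnick–Sarnak 1996, Lemma 3.10.) [cite: RudnickSarnak1996, Lemma 3.10] -/
def IsGood (ν : Fin r → ℕ) (μ : Fin s → ℕ) : Prop :=
  (∀ i, (ν i).Prime) ∧ (∀ j, (μ j).Prime) ∧ Function.Injective ν ∧ Function.Injective μ

open scoped Classical in
/-- `Π √ν_i = √(Π ν_i)`. [folklore] -/
theorem prod_sqrt_natCast {ι : Type*} (t : Finset ι) (ν : ι → ℕ) :
    ∏ i ∈ t, Real.sqrt (ν i) = Real.sqrt (∏ i ∈ t, (ν i : ℝ)) := by
  simp_rw [Real.sqrt_eq_rpow]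
  exact Real.finsetProd_rpow t _ (fun i _ ↦ Nat.cast_nonneg _) _

/-! ## The inner sum over `μ` -/

/-- **Inner bound**: for `P ≥ 1`,
`Σ_{μ ∈ [1,N]^s, Π μ = P} Π_j Λ(μ_j)/√μ_j ≤ (Λ^{*s})(P)/√P ≤ (log P)^s/√P`. [cite: RudnickSarnak1996, (3.49)] -/
theorem sum_tuples_ite_prod_le {s N P : ℕ} (hP : P ≠ 0) :
    ∑ μ ∈ tuples s N, (if ∏ j, μ j = P then ∏ j, (Λ (μ j) : ℝ) / Real.sqrt (μ j) else 0) ≤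
      Real.log P ^ s / Real.sqrt P := by
  classical
  have hnn : ∀ μ : Fin s → ℕ, 0 ≤ ∏ j, (Λ (μ j) : ℝ) / Real.sqrt (μ j) :=
    fun μ ↦ Finset.prod_nonneg fun _ _ ↦ div_nonneg vonMangoldt_nonneg (Real.sqrt_nonneg _)
  -- enlarge to `finMulAntidiag s P`
  have h1 : ∑ μ ∈ tuples s N, (if ∏ j, μ j = P then ∏ j, (Λ (μ j) : ℝ) / Real.sqrt (μ j) else 0) ≤
      ∑ μ ∈ Nat.finMulAntidiag s P, ∏ j, (Λ (μ j) : ℝ) / Real.sqrt (μ j) := by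
    rw [← Finset.sum_filter]
    refine Finset.sum_le_sum_of_subset_of_nonneg (fun μ hμ ↦ ?_) fun μ _ _ ↦ hnn μ
    rw [Finset.mem_filter] at hμ
    rw [Nat.mem_finMulAntidiag]
    exact ⟨hμ.2, hP⟩
  refine h1.trans ?_
  -- on `finMulAntidiag`, `Π √μ_j = √P`
  have h2 : ∀ μ ∈ Nat.finMulAntidiag s P, ∏ j, (Λ (μ j) : ℝ) / Real.sqrt (μ j) =
      (∏ j, (Λ (μ j) : ℝ)) / Real.sqrt P := by
    intro μ hμ
    rw [Nat.mem_finMulAntidiag] at hμ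
    rw [Finset.prod_div_distrib, prod_sqrt_natCast, ← Nat.cast_prod, hμ.1]
  rw [Finset.sum_congr rfl h2, ← Finset.sum_div]
  refine div_le_div_of_nonneg_right ?_ (Real.sqrt_nonneg _)
  -- tuple expansion: `Σ_{fMA} Π Λ(μ_j) = (Λ^{*s})(P) ≤ (log P)^s`
  have h3 : ∑ μ ∈ Nat.finMulAntidiag s P, ∏ j, (Λ (μ j) : ℝ) = ((Λ : ArithmeticFunction ℝ) ^ s) P := by
    rw [show (Λ : ArithmeticFunction ℝ) ^ s = ∏ _i : Fin s, (Λ : ArithmeticFunction ℝ) by simp,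
      ArithmeticFunction.prod_apply_eq_sum_finMulAntidiag]
  rw [h3]
  exact vonMangoldt_pow_le s P

/-! ## One-sided master bound -/

/-- **One-sided bound**: for any predicate `Q` on the `ν`-side,
`Σ_{ν: Q} Σ_μ [Πν = Πμ] w(ν; μ) ≤ (r log N)^s Σ_{ν: Q} Π_i Λ(ν_i)/ν_i`.
[cite: RudnickSarnak1996, (3.49)] -/
theorem sum_cfgWeight_filter_le (N : ℕ) (Q : (Fin r → ℕ) → Prop) [DecidablePred Q] :
    ∑ ν ∈ (tuples r N).filter Q, ∑ μ ∈ tuples s N, (if ∏ i, ν i = ∏ j, μ j then cfgWeight ν μ else 0) ≤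
      (r * Real.log N) ^ s * ∑ ν ∈ (tuples r N).filter Q, ∏ i, (Λ (ν i) : ℝ) / ν i := by
  classical
  rw [Finset.mul_sum]
  refine Finset.sum_le_sum fun ν hν ↦ ?_
  have hν' := (Finset.mem_filter.1 hν).1
  rw [mem_tuples] at hν'
  set P := ∏ i, ν i with hPdef
  have hP1 : 1 ≤ P := Finset.one_le_prod' fun i _ ↦ (hν' i).1
  have hP0 : P ≠ 0 := by omega
  have hPN : (P : ℝ) ≤ (N : ℝ) ^ r := by
    have : P ≤ N ^ r := by
      calc P = ∏ i, ν i := rfl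
        _ ≤ ∏ _i : Fin r, N := Finset.prod_le_prod' fun i _ ↦ (hν' i).2
        _ = N ^ r := by simp
    exact_mod_cast this
  have hlogP : Real.log P ≤ r * Real.log N := by
    rcases Nat.eq_zero_or_pos r with hr | hr
    · subst hr
      simp only [hPdef, Finset.univ_eq_empty, Finset.prod_empty, Nat.cast_one, Real.log_one, Nat.cast_zero, zero_mul, le_refl]
    · have hN : 1 ≤ N := (hν' ⟨0, hr⟩).1.trans (hν' ⟨0, hr⟩).2
      calc Real.log P ≤ Real.log ((N : ℝ) ^ r) := Real.log_le_log (by exact_mod_cast hP1) hPN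
        _ = r * Real.log N := by rw [Real.log_pow]
  -- factor out the `ν`-part
  have e : ∀ μ : Fin s → ℕ, (if P = ∏ j, μ j then cfgWeight ν μ else 0) =
      (∏ i, (Λ (ν i) : ℝ) / Real.sqrt (ν i)) * (if ∏ j, μ j = P then ∏ j, (Λ (μ j) : ℝ) / Real.sqrt (μ j) else 0) := by
    intro μ
    by_cases h : ∏ j, μ j = P
    · rw [if_pos h.symm, if_pos h, cfgWeight]
    · rw [if_neg (Ne.symm h), if_neg h, mul_zero]
  simp_rw [e]
  rw [← Finset.mul_sum]
  have hA : 0 ≤ ∏ i, (Λ (ν i) : ℝ) / Real.sqrt (ν i) :=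
    Finset.prod_nonneg fun _ _ ↦ div_nonneg vonMangoldt_nonneg (Real.sqrt_nonneg _)
  calc (∏ i, (Λ (ν i) : ℝ) / Real.sqrt (ν i)) * ∑ μ ∈ tuples s N, (if ∏ j, μ j = P then ∏ j, (Λ (μ j) : ℝ) / Real.sqrt (μ j) else 0)
      ≤ (∏ i, (Λ (ν i) : ℝ) / Real.sqrt (ν i)) * (Real.log P ^ s / Real.sqrt P) :=
        mul_le_mul_of_nonneg_left (sum_tuples_ite_prod_le hP0) hA
    _ ≤ (∏ i, (Λ (ν i) : ℝ) / Real.sqrt (ν i)) * ((r * Real.log N) ^ s / Real.sqrt P) := by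
        refine mul_le_mul_of_nonneg_left (div_le_div_of_nonneg_right ?_ (Real.sqrt_nonneg _)) hA
        exact pow_le_pow_left₀ (Real.log_natCast_nonneg P) hlogP s
    _ = (r * Real.log N) ^ s * ((∏ i, (Λ (ν i) : ℝ) / Real.sqrt (ν i)) / Real.sqrt P) := by ring
    _ = (r * Real.log N) ^ s * ∏ i, (Λ (ν i) : ℝ) / ν i := by
        congr 1
        rw [Finset.prod_div_distrib, Finset.prod_div_distrib, prod_sqrt_natCast, hPdef, Nat.cast_prod, div_div,
          Real.mul_self_sqrt (Finset.prod_nonneg fun i _ ↦ Nat.cast_nonneg _)]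

/-- The double sum is symmetric under exchanging the two sides. [folklore] -/
theorem sum_sum_ite_cfgWeight_comm (N : ℕ) (Q : (Fin s → ℕ) → Prop) [DecidablePred Q] :
    ∑ ν ∈ tuples r N, ∑ μ ∈ (tuples s N).filter Q, (if ∏ i, ν i = ∏ j, μ j then cfgWeight ν μ else 0) =
      ∑ μ ∈ (tuples s N).filter Q, ∑ ν ∈ tuples r N, (if ∏ j, μ j = ∏ i, ν i then cfgWeight μ ν else 0) := by
  rw [Finset.sum_comm]
  refine Finset.sum_congr rfl fun μ _ ↦ Finset.sum_congr rfl fun ν _ ↦ ?_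
  by_cases h : ∏ i, ν i = ∏ j, μ j
  · rw [if_pos h, if_pos h.symm, cfgWeight, cfgWeight, mul_comm]
  · rw [if_neg h, if_neg (Ne.symm h)]

/-- **One-sided bound, `μ`-side**:
`Σ_ν Σ_{μ: Q} [Πν = Πμ] w(ν; μ) ≤ (s log N)^r Σ_{μ: Q} Π_j Λ(μ_j)/μ_j`. [cite: RudnickSarnak1996, (3.49)] -/
theorem sum_cfgWeight_filter_le' (N : ℕ) (Q : (Fin s → ℕ) → Prop) [DecidablePred Q] :
    ∑ ν ∈ tuples r N, ∑ μ ∈ (tuples s N).filter Q, (if ∏ i, ν i = ∏ j, μ j then cfgWeight ν μ else 0) ≤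
      (s * Real.log N) ^ r * ∑ μ ∈ (tuples s N).filter Q, ∏ j, (Λ (μ j) : ℝ) / μ j := by
  rw [sum_sum_ite_cfgWeight_comm]
  exact sum_cfgWeight_filter_le N Q

/-! ## Product sums over tuples with one or two marked coordinates -/

/-- `Σ_{ν ∈ [1,N]^r} Π_i f(ν_i) = (Σ_{n ≤ N} f n)^r`. [folklore] -/
theorem sum_tuples_prod (N : ℕ) (f : ℕ → ℝ) : ∑ ν ∈ tuples r N, ∏ i, f (ν i) = (∑ n ∈ Finset.Icc 1 N, f n) ^ r := by
  rw [tuples, Finset.sum_prod_piFinset, Finset.prod_const, Finset.card_univ, Fintype.card_fin]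

/-- One marked coordinate: `Σ_ν [Q(ν_{i₀})] Π_i f(ν_i) = (Σ_{n: Q} f n) (Σ_n f n)^{r−1}`. [folklore] -/
theorem sum_tuples_ite_prod_eq (N : ℕ) (f : ℕ → ℝ) (i₀ : Fin r) (Q : ℕ → Prop) [DecidablePred Q] :
    ∑ ν ∈ tuples r N, (if Q (ν i₀) then ∏ i, f (ν i) else 0) =
      (∑ n ∈ (Finset.Icc 1 N).filter Q, f n) * (∑ n ∈ Finset.Icc 1 N, f n) ^ (r - 1) := by
  classical
  set g : Fin r → ℕ → ℝ := fun i n ↦ if i = i₀ then (if Q n then f n else 0) else f n with hg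
  have e : ∀ ν : Fin r → ℕ, (if Q (ν i₀) then ∏ i, f (ν i) else 0) = ∏ i, g i (ν i) := by
    intro ν
    rw [← Finset.mul_prod_erase Finset.univ (fun i ↦ g i (ν i)) (Finset.mem_univ i₀)]
    have h1 : ∏ i ∈ Finset.univ.erase i₀, g i (ν i) = ∏ i ∈ Finset.univ.erase i₀, f (ν i) :=
      Finset.prod_congr rfl fun i hi ↦ by simp only [hg, if_neg (Finset.ne_of_mem_erase hi)]
    rw [h1]
    simp only [hg, if_true]
    split_ifs with h
    · rw [← Finset.mul_prod_erase Finset.univ (fun i ↦ f (ν i)) (Finset.mem_univ i₀)]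
    · rw [zero_mul]
  simp_rw [e]
  rw [tuples, Finset.sum_prod_piFinset, ← Finset.mul_prod_erase Finset.univ _ (Finset.mem_univ i₀)]
  have h2 : ∀ i ∈ Finset.univ.erase i₀, ∑ n ∈ Finset.Icc 1 N, g i n = ∑ n ∈ Finset.Icc 1 N, f n :=
    fun i hi ↦ Finset.sum_congr rfl fun n _ ↦ by simp only [hg, if_neg (Finset.ne_of_mem_erase hi)]
  have h3 : ∑ n ∈ Finset.Icc 1 N, g i₀ n = ∑ n ∈ (Finset.Icc 1 N).filter Q, f n := by
    rw [Finset.sum_filter]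
    refine Finset.sum_congr rfl fun n _ ↦ ?_
    simp only [hg, if_pos rfl]
  rw [h3, Finset.prod_congr rfl h2, Finset.prod_const, Finset.card_erase_of_mem (Finset.mem_univ _),
    Finset.card_univ, Fintype.card_fin]

/-- Two marked coordinates: for `i₁ ≠ i₂`,
`Σ_ν [ν_{i₁} = ν_{i₂}] Π_i f(ν_i) = (Σ_n f(n)²) (Σ_n f n)^{r−2}`. [folklore] -/
theorem sum_tuples_ite_eq_prod_eq (N : ℕ) (f : ℕ → ℝ) {i₁ i₂ : Fin r} (hne : i₁ ≠ i₂) :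
    ∑ ν ∈ tuples r N, (if ν i₁ = ν i₂ then ∏ i, f (ν i) else 0) =
      (∑ n ∈ Finset.Icc 1 N, f n ^ 2) * (∑ n ∈ Finset.Icc 1 N, f n) ^ (r - 2) := by
  classical
  -- `[ν_{i₁} = ν_{i₂}] = Σ_m [ν_{i₁} = m] [ν_{i₂} = m]` for `ν ∈ [1,N]^r`
  have key : ∀ ν ∈ tuples r N, (if ν i₁ = ν i₂ then ∏ i, f (ν i) else 0) =
      ∑ m ∈ Finset.Icc 1 N, ∏ i, (if i = i₁ ∨ i = i₂ then (if ν i = m then f (ν i) else 0) else f (ν i)) := by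
    intro ν hν
    rw [mem_tuples] at hν
    have hsplit : ∀ m : ℕ, ∏ i, (if i = i₁ ∨ i = i₂ then (if ν i = m then f (ν i) else 0) else f (ν i)) =
        (if ν i₁ = m then f (ν i₁) else 0) * (if ν i₂ = m then f (ν i₂) else 0) *
          ∏ i ∈ (Finset.univ.erase i₁).erase i₂, f (ν i) := by
      intro m
      have hi₂ : i₂ ∈ Finset.univ.erase i₁ := Finset.mem_erase.2 ⟨hne.symm, Finset.mem_univ _⟩
      rw [← Finset.mul_prod_erase Finset.univ _ (Finset.mem_univ i₁), ← Finset.mul_prod_erase _ _ hi₂]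
      simp only [true_or, or_true, if_true]
      rw [mul_assoc]
      congr 2
      refine Finset.prod_congr rfl fun i hi ↦ ?_
      have h1 : i ≠ i₂ := Finset.ne_of_mem_erase hi
      have h2 : i ≠ i₁ := Finset.ne_of_mem_erase (Finset.mem_of_mem_erase hi)
      simp [h1, h2]
    simp_rw [hsplit]
    have hrest : ∏ i, f (ν i) = f (ν i₁) * f (ν i₂) * ∏ i ∈ (Finset.univ.erase i₁).erase i₂, f (ν i) := by
      have hi₂ : i₂ ∈ Finset.univ.erase i₁ := Finset.mem_erase.2 ⟨hne.symm, Finset.mem_univ _⟩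
      rw [← Finset.mul_prod_erase Finset.univ (fun i ↦ f (ν i)) (Finset.mem_univ i₁),
        ← Finset.mul_prod_erase _ (fun i ↦ f (ν i)) hi₂, mul_assoc]
    by_cases h : ν i₁ = ν i₂
    · rw [if_pos h, hrest, ← Finset.sum_mul]
      congr 1
      rw [Finset.sum_eq_single (ν i₁)]
      · rw [if_pos rfl, ← h, if_pos rfl]
      · intro m _ hm
        rw [if_neg (Ne.symm hm), zero_mul]
      · intro hm
        exact absurd (Finset.mem_Icc.2 (hν i₁)) hm
    · rw [if_neg h]
      symm
      refine Finset.sum_eq_zero fun m _ ↦ ?_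
      by_cases h1 : ν i₁ = m
      · rw [if_neg (show ν i₂ ≠ m by rw [← h1]; exact Ne.symm h), mul_zero, zero_mul]
      · rw [if_neg h1, zero_mul, zero_mul]
  rw [Finset.sum_congr rfl key, Finset.sum_comm]
  -- now each inner sum factorises
  have hfac : ∀ m : ℕ, ∑ ν ∈ tuples r N, ∏ i, (if i = i₁ ∨ i = i₂ then (if ν i = m then f (ν i) else 0) else f (ν i)) =
      (∑ n ∈ Finset.Icc 1 N, if n = m then f n else 0) ^ 2 * (∑ n ∈ Finset.Icc 1 N, f n) ^ (r - 2) := by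
    intro m
    have hsp := Finset.sum_prod_piFinset (Finset.Icc 1 N)
      (fun (i : Fin r) (x : ℕ) ↦ if i = i₁ ∨ i = i₂ then (if x = m then f x else 0) else f x)
    rw [tuples, hsp]
    have hi₂ : i₂ ∈ Finset.univ.erase i₁ := Finset.mem_erase.2 ⟨hne.symm, Finset.mem_univ _⟩
    rw [← Finset.mul_prod_erase Finset.univ _ (Finset.mem_univ i₁), ← Finset.mul_prod_erase _ _ hi₂]
    simp only [true_or, or_true, if_true]
    rw [← mul_assoc, ← sq]
    congr 1
    rw [Finset.prod_congr rfl (fun i hi ↦ ?_), Finset.prod_const, Finset.card_erase_of_mem hi₂,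
      Finset.card_erase_of_mem (Finset.mem_univ _), Finset.card_univ, Fintype.card_fin]
    · rfl
    · have h1 : i ≠ i₂ := Finset.ne_of_mem_erase hi
      have h2 : i ≠ i₁ := Finset.ne_of_mem_erase (Finset.mem_of_mem_erase hi)
      simp [h1, h2]
  simp_rw [hfac]
  rw [← Finset.sum_mul]
  congr 1
  refine Finset.sum_congr rfl fun m hm ↦ ?_
  rw [Finset.sum_ite_eq' (Finset.Icc 1 N) m f, if_pos hm]

/-! ## The bad configurations -/

/-- Union bound over a marked coordinate: for `F ≥ 0`,
`Σ_{ν: ∃ i, ¬P(ν_i)} F(ν) ≤ Σ_{i₀} Σ_ν [¬P(ν_{i₀})] F(ν)`. [folklore] -/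
theorem sum_filter_exists_le {N : ℕ} (F : (Fin r → ℕ) → ℝ) (hF : ∀ ν, 0 ≤ F ν) (P : ℕ → Prop) [DecidablePred P] :
    ∑ ν ∈ (tuples r N).filter (fun ν ↦ ∃ i, ¬ P (ν i)), F ν ≤ ∑ i₀ : Fin r, ∑ ν ∈ tuples r N, (if ¬ P (ν i₀) then F ν else 0) := by
  classical
  have hnn : ∀ (ν : Fin r → ℕ) (i : Fin r), 0 ≤ (if ¬ P (ν i) then F ν else 0) := by
    intro ν i
    by_cases h : P (ν i)
    · rw [if_neg (not_not_intro h)]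
    · rw [if_pos h]; exact hF ν
  rw [Finset.sum_comm, Finset.sum_filter]
  refine Finset.sum_le_sum fun ν _ ↦ ?_
  by_cases h : ∃ i, ¬ P (ν i)
  · rw [if_pos h]
    obtain ⟨i₀, hi₀⟩ := h
    refine le_trans ?_ (Finset.single_le_sum (f := fun i ↦ if ¬ P (ν i) then F ν else 0)
      (fun i _ ↦ hnn ν i) (Finset.mem_univ i₀))
    rw [if_pos hi₀]
  · rw [if_neg h]
    exact Finset.sum_nonneg fun i _ ↦ hnn ν i

/-- Union bound over pairs of coordinates: for `F ≥ 0`,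
`Σ_{ν not injective} F(ν) ≤ Σ_{i₁ ≠ i₂} Σ_ν [ν_{i₁} = ν_{i₂}] F(ν)`. [folklore] -/
theorem sum_filter_not_injective_le {N : ℕ} (F : (Fin r → ℕ) → ℝ) (hF : ∀ ν, 0 ≤ F ν) :
    ∑ ν ∈ (tuples r N).filter (fun ν ↦ ¬ Function.Injective ν), F ν ≤
      ∑ p ∈ (Finset.univ : Finset (Fin r × Fin r)).filter (fun p ↦ p.1 ≠ p.2),
        ∑ ν ∈ tuples r N, (if ν p.1 = ν p.2 then F ν else 0) := by
  classical
  have hnn : ∀ (ν : Fin r → ℕ) (p : Fin r × Fin r), 0 ≤ (if ν p.1 = ν p.2 then F ν else 0) := by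
    intro ν p
    by_cases h : ν p.1 = ν p.2
    · rw [if_pos h]; exact hF ν
    · rw [if_neg h]
  rw [Finset.sum_comm, Finset.sum_filter]
  refine Finset.sum_le_sum fun ν _ ↦ ?_
  by_cases h : Function.Injective ν
  · rw [if_neg (not_not_intro h)]
    exact Finset.sum_nonneg fun p _ ↦ hnn ν p
  · rw [if_pos h]
    obtain ⟨i₁, i₂, heq, hne⟩ := Function.not_injective_iff.1 h
    have hmem : (i₁, i₂) ∈ (Finset.univ : Finset (Fin r × Fin r)).filter (fun p ↦ p.1 ≠ p.2) := by
      simp [hne]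
    refine le_trans ?_ (Finset.single_le_sum (f := fun p : Fin r × Fin r ↦ if ν p.1 = ν p.2 then F ν else 0)
      (fun p _ ↦ hnn ν p) hmem)
    simp only [if_pos heq, le_refl]

/-- The `ν`-side with a proper prime power: `Σ_{ν: ∃ i, ν_i not prime} Π Λ(ν_i)/ν_i ≤ 7 r (Σ_n Λ(n)/n)^{r−1}`.
[cite: RudnickSarnak1996, Lemma 3.8] -/
theorem sum_prod_div_not_prime_le (N : ℕ) :
    ∑ ν ∈ (tuples r N).filter (fun ν ↦ ∃ i, ¬ (ν i).Prime), ∏ i, (Λ (ν i) : ℝ) / ν i ≤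
      7 * r * (∑ n ∈ Finset.Icc 1 N, (Λ n : ℝ) / n) ^ (r - 1) := by
  classical
  have hF : ∀ ν : Fin r → ℕ, 0 ≤ ∏ i, (Λ (ν i) : ℝ) / ν i :=
    fun ν ↦ Finset.prod_nonneg fun _ _ ↦ div_nonneg vonMangoldt_nonneg (Nat.cast_nonneg _)
  refine (sum_filter_exists_le _ hF Nat.Prime).trans ?_
  have h1 : ∀ i₀ : Fin r, ∑ ν ∈ tuples r N, (if ¬ (ν i₀).Prime then ∏ i, (Λ (ν i) : ℝ) / ν i else 0) ≤
      7 * (∑ n ∈ Finset.Icc 1 N, (Λ n : ℝ) / n) ^ (r - 1) := by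
    intro i₀
    rw [sum_tuples_ite_prod_eq N (fun n ↦ (Λ n : ℝ) / n) i₀ (fun n ↦ ¬ n.Prime)]
    exact mul_le_mul_of_nonneg_right (sum_vonMangoldt_div_self_not_prime_le N)
      (pow_nonneg (sum_vonMangoldt_div_self_nonneg N) _)
  calc ∑ i₀ : Fin r, ∑ ν ∈ tuples r N, (if ¬ (ν i₀).Prime then ∏ i, (Λ (ν i) : ℝ) / ν i else 0)
      ≤ ∑ _i₀ : Fin r, 7 * (∑ n ∈ Finset.Icc 1 N, (Λ n : ℝ) / n) ^ (r - 1) := Finset.sum_le_sum fun i₀ _ ↦ h1 i₀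
    _ = 7 * r * (∑ n ∈ Finset.Icc 1 N, (Λ n : ℝ) / n) ^ (r - 1) := by
        rw [Finset.sum_const, Finset.card_univ, Fintype.card_fin, nsmul_eq_mul]; ring

/-- The `ν`-side with a repetition: `Σ_{ν not injective} Π Λ(ν_i)/ν_i ≤ 3 r² (Σ_n Λ(n)/n)^{r−2}`.
[cite: RudnickSarnak1996, Lemma 3.9] -/
theorem sum_prod_div_not_injective_le (N : ℕ) :
    ∑ ν ∈ (tuples r N).filter (fun ν ↦ ¬ Function.Injective ν), ∏ i, (Λ (ν i) : ℝ) / ν i ≤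
      3 * r ^ 2 * (∑ n ∈ Finset.Icc 1 N, (Λ n : ℝ) / n) ^ (r - 2) := by
  classical
  have hF : ∀ ν : Fin r → ℕ, 0 ≤ ∏ i, (Λ (ν i) : ℝ) / ν i :=
    fun ν ↦ Finset.prod_nonneg fun _ _ ↦ div_nonneg vonMangoldt_nonneg (Nat.cast_nonneg _)
  refine (sum_filter_not_injective_le _ hF).trans ?_
  have h1 : ∀ p ∈ (Finset.univ : Finset (Fin r × Fin r)).filter (fun p ↦ p.1 ≠ p.2),
      ∑ ν ∈ tuples r N, (if ν p.1 = ν p.2 then ∏ i, (Λ (ν i) : ℝ) / ν i else 0) ≤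
        3 * (∑ n ∈ Finset.Icc 1 N, (Λ n : ℝ) / n) ^ (r - 2) := by
    intro p hp
    rw [Finset.mem_filter] at hp
    rw [sum_tuples_ite_eq_prod_eq N (fun n ↦ (Λ n : ℝ) / n) hp.2]
    refine mul_le_mul_of_nonneg_right ?_ (pow_nonneg (sum_vonMangoldt_div_self_nonneg N) _)
    have : ∑ n ∈ Finset.Icc 1 N, ((Λ n : ℝ) / n) ^ 2 = ∑ n ∈ Finset.Icc 1 N, (Λ n : ℝ) ^ 2 / (n : ℝ) ^ 2 :=
      Finset.sum_congr rfl fun n _ ↦ by rw [div_pow]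
    rw [this]
    exact sum_vonMangoldt_sq_div_sq_le N
  calc ∑ p ∈ (Finset.univ : Finset (Fin r × Fin r)).filter (fun p ↦ p.1 ≠ p.2),
        ∑ ν ∈ tuples r N, (if ν p.1 = ν p.2 then ∏ i, (Λ (ν i) : ℝ) / ν i else 0)
      ≤ ∑ _p ∈ (Finset.univ : Finset (Fin r × Fin r)).filter (fun p ↦ p.1 ≠ p.2),
          3 * (∑ n ∈ Finset.Icc 1 N, (Λ n : ℝ) / n) ^ (r - 2) := Finset.sum_le_sum h1
    _ ≤ ∑ _p ∈ (Finset.univ : Finset (Fin r × Fin r)), 3 * (∑ n ∈ Finset.Icc 1 N, (Λ n : ℝ) / n) ^ (r - 2) :=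
        Finset.sum_le_sum_of_subset_of_nonneg (Finset.filter_subset _ _) fun _ _ _ ↦
          mul_nonneg (by norm_num) (pow_nonneg (sum_vonMangoldt_div_self_nonneg N) _)
    _ = 3 * r ^ 2 * (∑ n ∈ Finset.Icc 1 N, (Λ n : ℝ) / n) ^ (r - 2) := by
        rw [Finset.sum_const, Finset.card_univ, Fintype.card_prod, Fintype.card_fin, nsmul_eq_mul]
        push_cast; ring

/-- The bad configurations lie in the union of the four classes. [folklore] -/
theorem not_isGood_iff (ν : Fin r → ℕ) (μ : Fin s → ℕ) :
    ¬ IsGood ν μ ↔ (∃ i, ¬ (ν i).Prime) ∨ (∃ j, ¬ (μ j).Prime) ∨ ¬ Function.Injective ν ∨ ¬ Function.Injective μ := by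
  rw [IsGood, not_and_or, not_and_or, not_and_or, not_forall, not_forall]

open scoped Classical in
/-- **The bad configurations are one logarithm smaller** (Rudnick–Sarnak 1996, Lemmas 3.8–3.9): with
`M₁ = Σ_{n ≤ N} Λ(n)/n` (`≤ 2 log N + 2 log 4`),
`Σ_{(ν,μ) bad, Πν = Πμ} w(ν;μ) ≤ (r log N)^s (7r M₁^{r−1} + 3r² M₁^{r−2}) + (s log N)^r (7s M₁^{s−1} + 3s² M₁^{s−2})`.
[cite: RudnickSarnak1996, Lemmas 3.8–3.9] -/
theorem sum_cfgWeight_bad_le (N : ℕ) :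
    ∑ ν ∈ tuples r N, ∑ μ ∈ tuples s N,
        (if ∏ i, ν i = ∏ j, μ j ∧ ¬ IsGood ν μ then cfgWeight ν μ else 0) ≤
      (r * Real.log N) ^ s * (7 * r * (∑ n ∈ Finset.Icc 1 N, (Λ n : ℝ) / n) ^ (r - 1) +
          3 * r ^ 2 * (∑ n ∈ Finset.Icc 1 N, (Λ n : ℝ) / n) ^ (r - 2)) +
        (s * Real.log N) ^ r * (7 * s * (∑ n ∈ Finset.Icc 1 N, (Λ n : ℝ) / n) ^ (s - 1) +
          3 * s ^ 2 * (∑ n ∈ Finset.Icc 1 N, (Λ n : ℝ) / n) ^ (s - 2)) := by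
  classical
  set C : (Fin r → ℕ) → (Fin s → ℕ) → ℝ := fun ν μ ↦ if ∏ i, ν i = ∏ j, μ j then cfgWeight ν μ else 0 with hC
  have hCnn : ∀ ν μ, 0 ≤ C ν μ := by
    intro ν μ
    simp only [hC]
    by_cases h : ∏ i, ν i = ∏ j, μ j
    · rw [if_pos h]; exact cfgWeight_nonneg ν μ
    · rw [if_neg h]
  have hite : ∀ (q : Prop) [Decidable q] (ν : Fin r → ℕ) (μ : Fin s → ℕ), 0 ≤ (if q then C ν μ else 0) := by
    intro q _ ν μ
    by_cases h : q
    · rw [if_pos h]; exact hCnn ν μ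
    · rw [if_neg h]
  -- pointwise: the bad indicator is dominated by the four class indicators
  have hpt : ∀ ν μ, (if ∏ i, ν i = ∏ j, μ j ∧ ¬ IsGood ν μ then cfgWeight ν μ else 0) ≤
      (if ∃ i, ¬ (ν i).Prime then C ν μ else 0) + (if ¬ Function.Injective ν then C ν μ else 0) +
        ((if ∃ j, ¬ (μ j).Prime then C ν μ else 0) + (if ¬ Function.Injective μ then C ν μ else 0)) := by
    intro ν μ
    have h4 := hite (∃ i, ¬ (ν i).Prime) ν μ
    have h5 := hite (¬ Function.Injective ν) ν μ
    have h6 := hite (∃ j, ¬ (μ j).Prime) ν μ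
    have h7 := hite (¬ Function.Injective μ) ν μ
    by_cases hc : ∏ i, ν i = ∏ j, μ j ∧ ¬ IsGood ν μ
    · rw [if_pos hc]
      obtain ⟨hprod, hbad⟩ := hc
      have hCeq : C ν μ = cfgWeight ν μ := by simp only [hC, if_pos hprod]
      rcases (not_isGood_iff ν μ).1 hbad with h1 | h1 | h1 | h1
      · have e : (if ∃ i, ¬ (ν i).Prime then C ν μ else 0) = cfgWeight ν μ := by rw [if_pos h1, hCeq]
        linarith
      · have e : (if ∃ j, ¬ (μ j).Prime then C ν μ else 0) = cfgWeight ν μ := by rw [if_pos h1, hCeq]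
        linarith
      · have e : (if ¬ Function.Injective ν then C ν μ else 0) = cfgWeight ν μ := by rw [if_pos h1, hCeq]
        linarith
      · have e : (if ¬ Function.Injective μ then C ν μ else 0) = cfgWeight ν μ := by rw [if_pos h1, hCeq]
        linarith
    · rw [if_neg hc]
      linarith
  refine (Finset.sum_le_sum fun ν _ ↦ Finset.sum_le_sum fun μ _ ↦ hpt ν μ).trans ?_
  simp only [Finset.sum_add_distrib]
  -- the four class sums
  have hA : ∑ ν ∈ tuples r N, ∑ μ ∈ tuples s N, (if ∃ i, ¬ (ν i).Prime then C ν μ else 0) ≤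
      (r * Real.log N) ^ s * (7 * r * (∑ n ∈ Finset.Icc 1 N, (Λ n : ℝ) / n) ^ (r - 1)) := by
    have e : ∑ ν ∈ tuples r N, ∑ μ ∈ tuples s N, (if ∃ i, ¬ (ν i).Prime then C ν μ else 0) =
        ∑ ν ∈ (tuples r N).filter (fun ν ↦ ∃ i, ¬ (ν i).Prime), ∑ μ ∈ tuples s N, C ν μ := by
      rw [Finset.sum_filter]
      refine Finset.sum_congr rfl fun ν _ ↦ ?_
      split_ifs <;> simp
    rw [e]
    refine (sum_cfgWeight_filter_le N _).trans ?_
    exact mul_le_mul_of_nonneg_left (sum_prod_div_not_prime_le N) (by positivity)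
  have hB : ∑ ν ∈ tuples r N, ∑ μ ∈ tuples s N, (if ¬ Function.Injective ν then C ν μ else 0) ≤
      (r * Real.log N) ^ s * (3 * r ^ 2 * (∑ n ∈ Finset.Icc 1 N, (Λ n : ℝ) / n) ^ (r - 2)) := by
    have e : ∑ ν ∈ tuples r N, ∑ μ ∈ tuples s N, (if ¬ Function.Injective ν then C ν μ else 0) =
        ∑ ν ∈ (tuples r N).filter (fun ν ↦ ¬ Function.Injective ν), ∑ μ ∈ tuples s N, C ν μ := by
      rw [Finset.sum_filter]
      refine Finset.sum_congr rfl fun ν _ ↦ ?_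
      split_ifs <;> simp
    rw [e]
    refine (sum_cfgWeight_filter_le N _).trans ?_
    exact mul_le_mul_of_nonneg_left (sum_prod_div_not_injective_le N) (by positivity)
  have hA' : ∑ ν ∈ tuples r N, ∑ μ ∈ tuples s N, (if ∃ j, ¬ (μ j).Prime then C ν μ else 0) ≤
      (s * Real.log N) ^ r * (7 * s * (∑ n ∈ Finset.Icc 1 N, (Λ n : ℝ) / n) ^ (s - 1)) := by
    have e : ∑ ν ∈ tuples r N, ∑ μ ∈ tuples s N, (if ∃ j, ¬ (μ j).Prime then C ν μ else 0) =
        ∑ ν ∈ tuples r N, ∑ μ ∈ (tuples s N).filter (fun μ ↦ ∃ j, ¬ (μ j).Prime), C ν μ := by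
      refine Finset.sum_congr rfl fun ν _ ↦ ?_
      rw [Finset.sum_filter]
    rw [e]
    refine (sum_cfgWeight_filter_le' N _).trans ?_
    exact mul_le_mul_of_nonneg_left (sum_prod_div_not_prime_le N) (by positivity)
  have hB' : ∑ ν ∈ tuples r N, ∑ μ ∈ tuples s N, (if ¬ Function.Injective μ then C ν μ else 0) ≤
      (s * Real.log N) ^ r * (3 * s ^ 2 * (∑ n ∈ Finset.Icc 1 N, (Λ n : ℝ) / n) ^ (s - 2)) := by
    have e : ∑ ν ∈ tuples r N, ∑ μ ∈ tuples s N, (if ¬ Function.Injective μ then C ν μ else 0) =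
        ∑ ν ∈ tuples r N, ∑ μ ∈ (tuples s N).filter (fun μ ↦ ¬ Function.Injective μ), C ν μ := by
      refine Finset.sum_congr rfl fun ν _ ↦ ?_
      rw [Finset.sum_filter]
    rw [e]
    refine (sum_cfgWeight_filter_le' N _).trans ?_
    exact mul_le_mul_of_nonneg_left (sum_prod_div_not_injective_le N) (by positivity)
  nlinarith [hA, hB, hA', hB']

/-- **Crude bound for all configurations**: `Σ_{Πν = Πμ} w(ν;μ) ≤ (r log N)^s (2 log N + 2 log 4)^r`.
[cite: RudnickSarnak1996, (3.49)] -/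
theorem sum_cfgWeight_le (N : ℕ) :
    ∑ ν ∈ tuples r N, ∑ μ ∈ tuples s N, (if ∏ i, ν i = ∏ j, μ j then cfgWeight ν μ else 0) ≤
      (r * Real.log N) ^ s * (2 * Real.log N + 2 * Real.log 4) ^ r := by
  classical
  have h := sum_cfgWeight_filter_le (s := s) N (fun _ : Fin r → ℕ ↦ True)
  rw [Finset.filter_true_of_mem (fun _ _ ↦ trivial)] at h
  refine h.trans (mul_le_mul_of_nonneg_left ?_ (by positivity))
  rw [sum_tuples_prod N (fun n ↦ (Λ n : ℝ) / n)]
  exact pow_le_pow_left₀ (sum_vonMangoldt_div_self_nonneg N) (sum_vonMangoldt_div_self_le N) r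

/-! ## The good configurations: permutations of distinct primes -/

/-- The prime factors of a product of distinct primes indexed injectively by `Fin r` are the values.
[folklore] -/
theorem primeFactors_prod_eq_image {ν : Fin r → ℕ} (hp : ∀ i, (ν i).Prime) (hinj : Function.Injective ν) :
    (∏ i, ν i).primeFactors = Finset.univ.image ν := by
  classical
  have e : ∏ i, ν i = ∏ p ∈ Finset.univ.image ν, p := by
    rw [Finset.prod_image fun i _ j _ h ↦ hinj h]
  rw [e]
  exact Nat.primeFactors_prod (by simpa using hp)

/-- **Good configurations force `r = s`**: if all entries are distinct primes on each side and
`Π ν = Π μ`, then `r = s`. [cite: RudnickSarnak1996, Lemma 3.10] -/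
theorem eq_of_isGood {ν : Fin r → ℕ} {μ : Fin s → ℕ} (hg : IsGood ν μ) (hprod : ∏ i, ν i = ∏ j, μ j) : r = s := by
  classical
  obtain ⟨hν, hμ, hiν, hiμ⟩ := hg
  have h1 := primeFactors_prod_eq_image hν hiν
  have h2 := primeFactors_prod_eq_image hμ hiμ
  rw [hprod, h2] at h1
  have := congrArg Finset.card h1
  rwa [Finset.card_image_of_injective _ hiμ, Finset.card_image_of_injective _ hiν, Finset.card_univ,
    Finset.card_univ, Fintype.card_fin, Fintype.card_fin, eq_comm] at this

open scoped Classical in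
/-- **The good sum vanishes for `r ≠ s`.** [cite: RudnickSarnak1996, Lemma 3.10] -/
theorem sum_good_eq_zero_of_ne (hrs : r ≠ s) (N : ℕ) (F : (Fin r → ℕ) → (Fin s → ℕ) → ℝ) :
    ∑ ν ∈ tuples r N, ∑ μ ∈ tuples s N, (if ∏ i, ν i = ∏ j, μ j ∧ IsGood ν μ then F ν μ else 0) = 0 := by
  refine Finset.sum_eq_zero fun ν _ ↦ Finset.sum_eq_zero fun μ _ ↦ ?_
  rw [if_neg]
  rintro ⟨hprod, hg⟩
  exact hrs (eq_of_isGood hg hprod)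

/-- For a good configuration with `Π ν = Π μ` (same index type), `μ` is a permutation of `ν`.
[cite: RudnickSarnak1996, Lemma 3.10] -/
theorem exists_perm_of_isGood {ν μ : Fin r → ℕ} (hg : IsGood ν μ) (hprod : ∏ i, ν i = ∏ j, μ j) :
    ∃ σ : Equiv.Perm (Fin r), μ = ν ∘ σ := by
  classical
  obtain ⟨hν, hμ, hiν, hiμ⟩ := hg
  have h1 := primeFactors_prod_eq_image hν hiν
  have h2 := primeFactors_prod_eq_image hμ hiμ
  rw [hprod, h2] at h1
  -- every `μ j` is some `ν i`
  have hex : ∀ j, ∃ i, ν i = μ j := by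
    intro j
    have : μ j ∈ Finset.univ.image ν := by rw [← h1]; exact Finset.mem_image_of_mem μ (Finset.mem_univ j)
    obtain ⟨i, -, hi⟩ := Finset.mem_image.1 this
    exact ⟨i, hi⟩
  choose τ hτ using hex
  have hτinj : Function.Injective τ := fun j j' h ↦ hiμ (by rw [← hτ j, ← hτ j', h])
  have hτbij : Function.Bijective τ := (Finite.injective_iff_bijective).1 hτinj
  refine ⟨Equiv.ofBijective τ hτbij, ?_⟩
  funext j
  simp [hτ j]

open scoped Classical in
/-- **The good configurations are the permutations of injective prime tuples**: for every `F`,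
`Σ_{ν, μ ∈ [1,N]^r, Πν = Πμ, good} F(ν, μ) = Σ_{σ ∈ S_r} Σ_{ν ∈ [1,N]^r prime-valued, injective} F(ν, ν ∘ σ)`.
(Rudnick–Sarnak 1996, Lemma 3.10 / (3.65): "`Σ_{σ ∈ S_r}`".) [cite: RudnickSarnak1996, Lemma 3.10] -/
theorem sum_good_eq_sum_perm (N : ℕ) (F : (Fin r → ℕ) → (Fin r → ℕ) → ℝ) :
    ∑ ν ∈ tuples r N, ∑ μ ∈ tuples r N, (if ∏ i, ν i = ∏ j, μ j ∧ IsGood ν μ then F ν μ else 0) =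
      ∑ σ : Equiv.Perm (Fin r), ∑ ν ∈ tuples r N,
        (if (∀ i, (ν i).Prime) ∧ Function.Injective ν then F ν (ν ∘ σ) else 0) := by
  classical
  -- both sides as sums over filtered product sets
  rw [← Finset.sum_product' (f := fun ν μ ↦ if ∏ i, ν i = ∏ j, μ j ∧ IsGood ν μ then F ν μ else 0),
    ← Finset.sum_filter,
    ← Finset.sum_product' (f := fun (σ : Equiv.Perm (Fin r)) ν ↦ if (∀ i, (ν i).Prime) ∧ Function.Injective ν then F ν (ν ∘ σ) else 0),
    ← Finset.sum_filter]
  symm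
  refine Finset.sum_bij (fun x _ ↦ (x.2, x.2 ∘ x.1)) ?_ ?_ ?_ ?_
  · rintro ⟨σ, ν⟩ hx
    simp only [Finset.mem_filter, Finset.mem_product, Finset.mem_univ, true_and] at hx
    obtain ⟨hν, hp, hinj⟩ := hx
    simp only [Finset.mem_filter, Finset.mem_product]
    rw [mem_tuples] at hν ⊢
    refine ⟨⟨hν, ?_⟩, ?_, ⟨hp, fun j ↦ hp (σ j), hinj, hinj.comp σ.injective⟩⟩
    · rw [mem_tuples]; exact fun j ↦ hν (σ j)
    · exact (Fintype.prod_equiv σ (ν ∘ σ) ν fun _ ↦ rfl).symm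
  · rintro ⟨σ, ν⟩ hx ⟨σ', ν'⟩ hx' h
    simp only [Prod.mk.injEq] at h
    obtain ⟨rfl, h2⟩ := h
    simp only [Finset.mem_filter, Finset.mem_product, Finset.mem_univ, true_and] at hx
    have hinj := hx.2.2
    have : σ = σ' := by
      ext j
      have := congrFun h2 j
      exact congrArg Fin.val (hinj this)
    rw [this]
  · rintro ⟨ν, μ⟩ hx
    simp only [Finset.mem_filter, Finset.mem_product] at hx
    obtain ⟨⟨hν, hμ⟩, hprod, hg⟩ := hx
    obtain ⟨σ, rfl⟩ := exists_perm_of_isGood hg hprod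
    refine ⟨(σ, ν), ?_, rfl⟩
    simp only [Finset.mem_filter, Finset.mem_product, Finset.mem_univ, true_and]
    exact ⟨hν, hg.1, hg.2.2.1⟩
  · rintro ⟨σ, ν⟩ _
    rfl

/-! ## Coincidences among prime tuples -/

/-- **Repeated primes**: `Σ_{ν ∈ [1,N]^r not injective} Π_i Λ(ν_i)²/ν_i ≤ 3 r² log² N (log N (2 log N + 2 log 4))^{r−2}`
(the overcount when the injectivity constraint is dropped from the main term; Rudnick–Sarnak 1996,
Lemma 3.10: "the condition of summing over distinct primes can be omitted").
[cite: RudnickSarnak1996, Lemma 3.10] -/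
theorem sum_prod_sq_div_not_injective_le (N : ℕ) :
    ∑ ν ∈ (tuples r N).filter (fun ν ↦ ¬ Function.Injective ν), ∏ i, (Λ (ν i) : ℝ) ^ 2 / ν i ≤
      r ^ 2 * (3 * Real.log N ^ 2) * (Real.log N * (2 * Real.log N + 2 * Real.log 4)) ^ (r - 2) := by
  classical
  have hF : ∀ ν : Fin r → ℕ, 0 ≤ ∏ i, (Λ (ν i) : ℝ) ^ 2 / ν i :=
    fun ν ↦ Finset.prod_nonneg fun _ _ ↦ div_nonneg (sq_nonneg _) (Nat.cast_nonneg _)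
  refine (sum_filter_not_injective_le _ hF).trans ?_
  have hS0 : 0 ≤ ∑ n ∈ Finset.Icc 1 N, (Λ n : ℝ) ^ 2 / n := Finset.sum_nonneg fun n _ ↦ div_nonneg (sq_nonneg _) (Nat.cast_nonneg _)
  have hS := sum_vonMangoldt_sq_div_self_le N
  have h1 : ∀ p ∈ (Finset.univ : Finset (Fin r × Fin r)).filter (fun p ↦ p.1 ≠ p.2),
      ∑ ν ∈ tuples r N, (if ν p.1 = ν p.2 then ∏ i, (Λ (ν i) : ℝ) ^ 2 / ν i else 0) ≤
        3 * Real.log N ^ 2 * (Real.log N * (2 * Real.log N + 2 * Real.log 4)) ^ (r - 2) := by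
    intro p hp
    rw [Finset.mem_filter] at hp
    rw [sum_tuples_ite_eq_prod_eq N (fun n ↦ (Λ n : ℝ) ^ 2 / n) hp.2]
    refine mul_le_mul ?_ (pow_le_pow_left₀ hS0 hS _) (pow_nonneg hS0 _) (by positivity)
    have : ∑ n ∈ Finset.Icc 1 N, ((Λ n : ℝ) ^ 2 / n) ^ 2 = ∑ n ∈ Finset.Icc 1 N, (Λ n : ℝ) ^ 4 / (n : ℝ) ^ 2 :=
      Finset.sum_congr rfl fun n _ ↦ by rw [div_pow]; ring
    rw [this]
    exact sum_vonMangoldt_pow_four_div_sq_le N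
  calc ∑ p ∈ (Finset.univ : Finset (Fin r × Fin r)).filter (fun p ↦ p.1 ≠ p.2),
        ∑ ν ∈ tuples r N, (if ν p.1 = ν p.2 then ∏ i, (Λ (ν i) : ℝ) ^ 2 / ν i else 0)
      ≤ ∑ _p ∈ (Finset.univ : Finset (Fin r × Fin r)).filter (fun p ↦ p.1 ≠ p.2),
          3 * Real.log N ^ 2 * (Real.log N * (2 * Real.log N + 2 * Real.log 4)) ^ (r - 2) := Finset.sum_le_sum h1
    _ ≤ ∑ _p ∈ (Finset.univ : Finset (Fin r × Fin r)),
          3 * Real.log N ^ 2 * (Real.log N * (2 * Real.log N + 2 * Real.log 4)) ^ (r - 2) :=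
        Finset.sum_le_sum_of_subset_of_nonneg (Finset.filter_subset _ _) fun _ _ _ ↦
          mul_nonneg (by positivity) (pow_nonneg (mul_nonneg (Real.log_natCast_nonneg N) (by
            have := Real.log_nonneg (by norm_num : (1:ℝ) ≤ 4); have := Real.log_natCast_nonneg N; positivity)) _)
    _ = r ^ 2 * (3 * Real.log N ^ 2) * (Real.log N * (2 * Real.log N + 2 * Real.log 4)) ^ (r - 2) := by
        rw [Finset.sum_const, Finset.card_univ, Fintype.card_prod, Fintype.card_fin, nsmul_eq_mul]
        push_cast; ring

/-- The weight of a permuted prime tuple: `w(ν; ν ∘ σ) = Π_i Λ(ν_i)²/ν_i`. [folklore] -/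
theorem cfgWeight_comp_perm (ν : Fin r → ℕ) (σ : Equiv.Perm (Fin r)) :
    cfgWeight ν (ν ∘ σ) = ∏ i, (Λ (ν i) : ℝ) ^ 2 / ν i := by
  unfold cfgWeight
  rw [Fintype.prod_equiv σ (fun j ↦ (Λ ((ν ∘ σ) j) : ℝ) / Real.sqrt ((ν ∘ σ) j))
    (fun i ↦ (Λ (ν i) : ℝ) / Real.sqrt (ν i)) (fun _ ↦ rfl), ← Finset.prod_mul_distrib]
  refine Finset.prod_congr rfl fun i _ ↦ ?_
  rw [div_mul_div_comm, Real.mul_self_sqrt (Nat.cast_nonneg _), sq]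

end RudnickSarnakN

end Literature.NumberTheory.LFunctions

end
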